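import Literature.AnabelianGeometry.SemiGraphs.PSCCuspidalCriterionSmoothCurveOrigin
import Literature.AnabelianGeometry.SemiGraphs.PSCSmoothCurveCuspidalCondition
import Literature.AnabelianGeometry.SemiGraphs.PSCCuspidalCharacterizationConverse
import Literature.AnabelianGeometry.SemiGraphs.ProSigmaCompletionTFG
import HarnessLib

/-!
# [IUTchI] Rmk. 1.2.3 (iv) (cuspidal) and [CombGC] Thm. 1.6 (i) HOLD at genuine pro-`l` smooth-curve data

Mochizuki, *Inter-universal Teichmüller theory I* [IUTchI] Rmk. 1.2.3 (iv) (kurims manuscript pp. 41–42: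
"the cuspidal edge-like subgroups of `Π_G` may be characterized as the maximal closed subgroups `A ⊆ Π_G`
isomorphic to `ℤ_l` which satisfy the following condition: for every characteristic open subgroup …
the cyclic finite étale covering … is cuspidally totally ramified") and *A combinatorial version of the
Grothendieck conjecture* [CombGC] Thm. 1.6 (i) p. 13 ("`α` is numerically cuspidal if and only if it is
group-theoretically cuspidal").  PROOF-ONLY file (abc-iut-f-164, FACT tranche 164; rows F-1931
`PSCDatum.CuspidalEdgeLikeCharacterizationHolds` and F-0458 `PSCDatum.NumericallyCuspidalIffHolds`,
both schemata over the origin parameter `Ω : PSCOrigin` typed by abc-iut-L3-t4).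

COMPOSITION FILE.  The converse half of the cuspidal characterization follows from the direct half for
every datum over a profinite, topologically finitely generated `Π` (`PSCCuspidalCharacterizationConverse.lean`,
abc-iut-f-164: compactness + Serre's theorem ⇒ characteristic open cores are characteristic and cofinal);
at data of SMOOTH-CURVE shape (abc-iut-L3-t4's `PSCSmoothCurveShape.lean`: one vertex, no nodes, cusp
groups the closed cusp inertia groups of a pro-`Σ` completion `ι : Γ_{g,r} → Π` of a hyperbolic punctured
surface group, `Π` profinite — hence topologically finitely generated) the direct half is abc-iut-L3-t4's
THEOREM `cuspidalEdgeLikeCharacterization_mp_of_smoothCurve` (malnormality of cusp inertia).  Consequences: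

* `cuspidalEdgeLikeCharacterization_of_smoothCurve`: the typed `iff` of Rmk. 1.2.3 (iv) (row F-1930)
  HOLDS at every smooth-curve datum; `cuspidalEdgeLikeCharacterizationHolds_of_smoothCurve`: **F-1931
  HOLDS at every origin of smooth-curve data** (both halves; any completion type `Σ'`);
* `numericallyCuspidalIffHolds_of_smoothCurve`: **[CombGC] Thm. 1.6 (i) as printed (F-0458) HOLDS at
  every pro-`l` smooth-curve origin**, unconditionally (composition with
  `numericallyCuspidalIffHolds_of_smoothCurve_of_characterization`; the shape-free reduction "F-0458 ⇐
  F-0459 + the direct half of F-1931" at pro-`l` profinite origins is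
  `numericallyCuspidalIffHolds_of_openInter_of_mp` in `PSCCuspidalCharacterizationConverse.lean`);
* `exists_proL_tripodOrigin_thm16i_holds`: such an origin is INHABITED by the GENUINE pro-`l` tripod
  (`Π` = the maximal pro-`l` quotient of `π₁(P¹ ∖ {0,1,∞}) = Γ_{0,3}`), at which F-0438 ∧ F-0459 ∧
  F-0440 ∧ F-0461 ∧ F-0443 ∧ F-1931 ∧ F-0458 all HOLD — a kernel instance of the cuspidal criterion at
  data WITH cusps.

Honest scope: instance forms at genuine one-component data (consistency evidence and non-vacuity for
the typed rows), not the printed theorems for all pointed stable curves.  Nothing here takes a side on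
[IUTchIII] Cor. 3.12.
[cite: Mochizuki2012, IUTchI Rmk 1.2.3(iv) pp.41-42] [cite: MochizukiCombGC2007, Thm 1.6(i) p.13]
[cite: DDMSAnalyticProP1999, Thm 1.17]
-/

noncomputable section

namespace Literature.AnabelianGeometry.SemiGraphs

open scoped Pointwise
open Literature.GroupTheory.CombinatorialGroupTheory
open Literature.AnabelianGeometry.AbsoluteAnabelian (IsTopologicallyFinitelyGenerated)
open SemiGraphOfAnabelioids (IsProSigmaCompletion)

universe u

namespace PSCDatum

variable {P : Type u} [Group P] [TopologicalSpace P] [IsTopologicalGroup P]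

/-! ### A. [IUTchI] Rmk. 1.2.3 (iv) (cuspidal) at smooth-curve data -/

section SmoothCurve

variable [CompactSpace P] [T2Space P] [TotallyDisconnectedSpace P]
variable {Sigma : Set ℕ} {g r : ℕ}

/-- **[IUTchI] Rmk. 1.2.3 (iv), cuspidal part, as typed (`CuspidalEdgeLikeCharacterization`, row
F-1930) HOLDS at every datum of smooth-curve shape**: the direct half is abc-iut-L3-t4's
`cuspidalEdgeLikeCharacterization_mp_of_smoothCurve`, the converse half follows from it by
`cuspidalEdgeLikeCharacterization_of_mp` (`Π` is topologically finitely generated as a pro-`Σ` completion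
of `Γ_{g,r}`; pro-`l` for the `l` with `Σ = {l}` by the datum's field `proSigma`).
[cite: Mochizuki2012, IUTchI Rmk 1.2.3(iv) pp.41-42] -/
theorem cuspidalEdgeLikeCharacterization_of_smoothCurve (hne : Sigma.Nonempty)
    (hprime : ∀ p ∈ Sigma, p.Prime) (h : PuncturedSurfaceGroup.IsHyperbolicType g r)
    (ι : PuncturedSurfaceGroup g r →* P) (hι : IsProSigmaCompletion Sigma ι) (G : PSCDatum P)
    (e : G.graph.C ≃ Fin r)
    (hC : ∀ c, G.cuspGp c =
      ((PuncturedSurfaceGroup.cuspInertia (g := g) (e c)).map ι).topologicalClosure) :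
    G.CuspidalEdgeLikeCharacterization :=
  G.cuspidalEdgeLikeCharacterization_of_mp
    (IsProSigmaCompletion.isTopologicallyFinitelyGenerated_of_puncturedSurfaceGroup (MulEquiv.refl _) hι)
    fun A hA => G.cuspidalEdgeLikeCharacterization_mp_of_smoothCurve hne hprime h ι hι e hC A hA

end SmoothCurve

/-! ### B. Origin level: F-1931 and F-0458 HOLD at (pro-`l`) smooth-curve origins -/

section Origin

variable (Ω : PSCOrigin.{u}) (l : ℕ)

/-- **F-1931 ([IUTchI] Rmk. 1.2.3 (iv), cuspidal) HOLDS at every origin of smooth-curve-shaped data**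
(any completion type). [cite: Mochizuki2012, IUTchI Rmk 1.2.3(iv) pp.41-42] -/
theorem cuspidalEdgeLikeCharacterizationHolds_of_smoothCurve
    (hΩ : ∀ ⦃Q : Type u⦄ [Group Q] [TopologicalSpace Q] [IsTopologicalGroup Q] (G : PSCDatum Q),
      Ω.IsOfPSCType G → CompactSpace Q ∧ T2Space Q ∧ TotallyDisconnectedSpace Q ∧ IsEmpty G.graph.N ∧
        (∃ v₀ : G.graph.V, ∀ w, w = v₀) ∧
        ∃ (S : Set ℕ) (g r : ℕ) (ι : PuncturedSurfaceGroup g r →* Q) (e : G.graph.C ≃ Fin r),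
          S.Nonempty ∧ (∀ p ∈ S, p.Prime) ∧ PuncturedSurfaceGroup.IsHyperbolicType g r ∧
          IsProSigmaCompletion S ι ∧
          ∀ c, G.cuspGp c = ((PuncturedSurfaceGroup.cuspInertia (g := g) (e c)).map ι).topologicalClosure) :
    CuspidalEdgeLikeCharacterizationHolds Ω := by
  intro Q _ _ _ G hG
  obtain ⟨hc, ht, hd, -, -, S, g, r, ι, e, hne, hprime, hh, hι, hC⟩ := hΩ G hG
  exact G.cuspidalEdgeLikeCharacterization_of_smoothCurve hne hprime hh ι hι e hC

/-- **[CombGC] Theorem 1.6 (i) as printed (F-0458) HOLDS at every pro-`l` smooth-curve origin**,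
unconditionally: F-1931 holds there (`cuspidalEdgeLikeCharacterizationHolds_of_smoothCurve`) and
F-0458 ⇐ F-1931 there (`numericallyCuspidalIffHolds_of_smoothCurve_of_characterization`).
[cite: MochizukiCombGC2007, Thm 1.6(i) p.13] -/
theorem numericallyCuspidalIffHolds_of_smoothCurve
    (hΩ : ∀ ⦃Q : Type u⦄ [Group Q] [TopologicalSpace Q] [IsTopologicalGroup Q] (G : PSCDatum Q),
      Ω.IsOfPSCType G → CompactSpace Q ∧ T2Space Q ∧ TotallyDisconnectedSpace Q ∧ IsEmpty G.graph.N ∧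
        (∃ v₀ : G.graph.V, ∀ w, w = v₀) ∧
        ∃ (S : Set ℕ) (g r : ℕ) (ι : PuncturedSurfaceGroup g r →* Q) (e : G.graph.C ≃ Fin r),
          S.Nonempty ∧ (∀ p ∈ S, p.Prime) ∧ PuncturedSurfaceGroup.IsHyperbolicType g r ∧
          IsProSigmaCompletion S ι ∧
          ∀ c, G.cuspGp c = ((PuncturedSurfaceGroup.cuspInertia (g := g) (e c)).map ι).topologicalClosure)
    (hSig : ∀ ⦃Q : Type u⦄ [Group Q] [TopologicalSpace Q] [IsTopologicalGroup Q] (G : PSCDatum Q),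
      Ω.IsOfPSCType G → G.Sigma = {l}) :
    NumericallyCuspidalIffHolds Ω :=
  numericallyCuspidalIffHolds_of_smoothCurve_of_characterization Ω l hΩ hSig
    (cuspidalEdgeLikeCharacterizationHolds_of_smoothCurve Ω hΩ)

end Origin

/-! ### C. The genuine pro-`l` tripod -/

/-- **At the origin of pro-`l` smooth-curve data — inhabited by the GENUINE pro-`l` tripod — F-0438,
F-0459, F-0440, F-0461, F-0443, F-1931 and F-0458 all HOLD.**  For a prime `l`, `Ω` declares "of
PSC-type" exactly the smooth-curve-shaped data with `Σ = {l}`; it contains the datum `Π` = a pro-`{l}`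
completion of `Γ_{0,3} = π₁(P¹ ∖ {0,1,∞})` (one vertex, `Π_v = Π`, genus `0`, three cusps
`Π_{c_i} = closure ι⟨c_i⟩`); Prop. 1.2 (ii)/(i), Prop. 1.5 (i), Thm. 1.6 (iii), Prop. 1.5 (ii) hold there
by abc-iut-L3-t4's smooth-curve instance forms, [IUTchI] Rmk. 1.2.3 (iv) (cuspidal) and [CombGC] Thm.
1.6 (i) by this file.  Instance forms at genuine one-component data; not the printed theorems for all
pointed stable curves. [cite: MochizukiCombGC2007, Thm 1.6(i) p.13] -/
theorem exists_proL_tripodOrigin_thm16i_holds (l : ℕ) (hl : l.Prime) :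
    ∃ Ω : PSCOrigin.{0},
      (∃ (Q : ProfiniteGrp.{0}) (ι : PuncturedSurfaceGroup 0 3 →* Q) (G : PSCDatum Q),
        IsProSigmaCompletion {l} ι ∧ Ω.IsOfPSCType G ∧ G.Sigma = {l} ∧ G.graph.i = 1 ∧ G.graph.n = 0 ∧
          G.graph.r = 3 ∧ (∀ v, G.vertGp v = ⊤ ∧ G.genus v = 0) ∧
          ∀ c, ∃ i : Fin 3, G.cuspGp c =
            ((PuncturedSurfaceGroup.cuspInertia (g := 0) i).map ι).topologicalClosure) ∧
      CommensurableTerminalityHolds Ω ∧ OpenInterDeterminesComponentHolds Ω ∧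
      EdgeLikeIncidenceHolds Ω ∧ UnrVerticialIffHolds Ω ∧ GraphicIffEdgeLikeVerticialHolds Ω ∧
      CuspidalEdgeLikeCharacterizationHolds Ω ∧ NumericallyCuspidalIffHolds Ω := by
  let Ω : PSCOrigin.{0} :=
    ⟨fun {Q} _ _ G => ∃ (_ : IsTopologicalGroup Q), CompactSpace Q ∧ T2Space Q ∧
      TotallyDisconnectedSpace Q ∧ IsEmpty G.graph.N ∧ (∀ v, G.vertGp v = ⊤) ∧
      (∃ v₀ : G.graph.V, ∀ w, w = v₀) ∧ G.Sigma = {l} ∧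
      ∃ (S : Set ℕ) (g r : ℕ) (ι : PuncturedSurfaceGroup g r →* Q) (e : G.graph.C ≃ Fin r),
        S.Nonempty ∧ (∀ p ∈ S, p.Prime) ∧ PuncturedSurfaceGroup.IsHyperbolicType g r ∧
        IsProSigmaCompletion S ι ∧
        ∀ c, G.cuspGp c = ((PuncturedSurfaceGroup.cuspInertia (g := g) (e c)).map ι).topologicalClosure⟩
  obtain ⟨Q, ι, hι⟩ :=
    IsProSigmaCompletion.exists_isProSigmaCompletion (PuncturedSurfaceGroup 0 3) ({l} : Set ℕ)
  let T : PSCDatum Q :=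
    { Sigma := {l}
      sigma_prime := fun p hp => by rw [Set.mem_singleton_iff.mp hp]; exact hl
      sigma_nonempty := ⟨l, rfl⟩
      graph := { V := Unit, N := Empty, C := Fin 3, nodeEnds := Empty.elim, cuspEnd := fun _ => () }
      vertGp := fun _ => ⊤
      nodeGp := Empty.elim
      cuspGp := fun i => ((PuncturedSurfaceGroup.cuspInertia (g := 0) i).map ι).topologicalClosure
      genus := fun _ => 0
      isClosed_vertGp := fun _ => by rw [Subgroup.coe_top]; exact isClosed_univ
      isClosed_nodeGp := fun e => e.elim
      isClosed_cuspGp := fun _ => Subgroup.isClosed_topologicalClosure _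
      nodeGp_le := fun e => e.elim
      cuspGp_le := fun _ => ⟨1, le_top⟩
      proSigma := isProSigma_of_isProSigmaCompletion hι }
  have hT : Ω.IsOfPSCType T :=
    ⟨inferInstance, inferInstance, inferInstance, inferInstance, inferInstanceAs (IsEmpty Empty),
      fun _ => rfl, ⟨(), fun _ => rfl⟩, rfl, {l}, 0, 3, ι, Equiv.refl _, ⟨l, rfl⟩,
      fun p hp => by rw [Set.mem_singleton_iff.mp hp]; exact hl,
      by unfold PuncturedSurfaceGroup.IsHyperbolicType; norm_num, hι, fun _ => rfl⟩
  have hsc : ∀ ⦃Q : Type⦄ [Group Q] [TopologicalSpace Q] [IsTopologicalGroup Q] (G : PSCDatum Q),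
      Ω.IsOfPSCType G → CompactSpace Q ∧ T2Space Q ∧ TotallyDisconnectedSpace Q ∧ IsEmpty G.graph.N ∧
        (∃ v₀ : G.graph.V, ∀ w, w = v₀) ∧
        ∃ (S : Set ℕ) (g r : ℕ) (ι : PuncturedSurfaceGroup g r →* Q) (e : G.graph.C ≃ Fin r),
          S.Nonempty ∧ (∀ p ∈ S, p.Prime) ∧ PuncturedSurfaceGroup.IsHyperbolicType g r ∧
          IsProSigmaCompletion S ι ∧
          ∀ c, G.cuspGp c =
            ((PuncturedSurfaceGroup.cuspInertia (g := g) (e c)).map ι).topologicalClosure := by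
    intro Q _ _ _ G hG
    obtain ⟨_, h1, h2, h3, h4, -, h6, -, h7⟩ := hG
    exact ⟨h1, h2, h3, h4, h6, h7⟩
  have hsc' : ∀ ⦃Q : Type⦄ [Group Q] [TopologicalSpace Q] [IsTopologicalGroup Q] (G : PSCDatum Q),
      Ω.IsOfPSCType G → CompactSpace Q ∧ T2Space Q ∧ TotallyDisconnectedSpace Q ∧ IsEmpty G.graph.N ∧
        (∀ v, G.vertGp v = ⊤) ∧ (∃ v₀ : G.graph.V, ∀ w, w = v₀) ∧
        ∃ (S : Set ℕ) (g r : ℕ) (ι : PuncturedSurfaceGroup g r →* Q) (e : G.graph.C ≃ Fin r),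
          S.Nonempty ∧ (∀ p ∈ S, p.Prime) ∧ PuncturedSurfaceGroup.IsHyperbolicType g r ∧
          IsProSigmaCompletion S ι ∧
          ∀ c, G.cuspGp c =
            ((PuncturedSurfaceGroup.cuspInertia (g := g) (e c)).map ι).topologicalClosure := by
    intro Q _ _ _ G hG
    obtain ⟨_, h1, h2, h3, h4, h5, h6, -, h7⟩ := hG
    exact ⟨h1, h2, h3, h4, h5, h6, h7⟩
  have htop : ∀ ⦃Q : Type⦄ [Group Q] [TopologicalSpace Q] (G : PSCDatum Q), Ω.IsOfPSCType G →
      IsEmpty G.graph.N ∧ (∀ v, G.vertGp v = ⊤) ∧ Nonempty G.graph.V := by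
    intro Q _ _ G hG
    obtain ⟨_, -, -, -, h4, h5, ⟨v₀, -⟩, -⟩ := hG
    exact ⟨h4, h5, ⟨v₀⟩⟩
  have hSig : ∀ ⦃Q : Type⦄ [Group Q] [TopologicalSpace Q] [IsTopologicalGroup Q] (G : PSCDatum Q),
      Ω.IsOfPSCType G → G.Sigma = {l} := by
    intro Q _ _ _ G hG
    obtain ⟨_, -, -, -, -, -, -, h, -⟩ := hG
    exact h
  exact ⟨Ω, ⟨Q, ι, T, hι, hT, rfl, rfl, rfl, rfl, fun _ => ⟨rfl, rfl⟩, fun c => ⟨c, rfl⟩⟩,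
    commensurableTerminalityHolds_of_smoothCurve Ω hsc',
    openInterDeterminesComponentHolds_of_smoothCurve Ω hsc,
    edgeLikeIncidenceHolds_of_vertGp_eq_top Ω htop,
    unrVerticialIffHolds_of_vertGp_eq_top Ω (fun _ _ _ G hG => ⟨(htop G hG).2.1, (htop G hG).2.2⟩),
    graphicIffEdgeLikeVerticialHolds_of_smoothCurve Ω hsc' htop,
    cuspidalEdgeLikeCharacterizationHolds_of_smoothCurve Ω hsc,
    numericallyCuspidalIffHolds_of_smoothCurve Ω l hsc hSig⟩

end PSCDatum

end Literature.AnabelianGeometry.SemiGraphs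

end
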